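import Summits.BirchSwinnertonDyer.Rank1Residual.Supersingular.KobayashiMainConjectureX6BSTWCellChainThree
import Summits.BirchSwinnertonDyer.BirchSwinnertonDyer.Theorems.SignedLowerHalvesKobayashiLowerHalfSemistableScopeS
import HarnessLib

/-!
# Crux `KobayashiLowerHalfSemistable` (route `SignedLowerHalves`, item 2 = stmt-BirchSwinnertonDyer-19000) BY NAME
# modulo {S-scoped preprint tier at `p ≥ 5`, the CELL-CHAIN binder at `p = 3`, modularity, Diamond/Ribet}
# (cell `bsd-ssimc`; object «P3CHAIN-TYPE-1» consumer — planner g32 D32-4, inventory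
# `HOME/bsd-ssimc-plan/P3CHAIN-INVENTORY-g32.md` 2852265edaedf112 §3.1; filed by k3-c2 g18 after the statement file
# `…Supersingular/KobayashiMainConjectureX6BSTWCellChainThree.lean` (p562281) landed)

HONEST FRAMING: CONDITIONAL compositions (`conditional-result`); the item stays OPEN. The only change relative to
`KobayashiLowerHalfSemistable_of_tiersS_S3` (p441716) is the `p = 3` binder: the preprint-on-preprint tier
`BurungaleSkinnerTianWan2024_thm13_scopedAtThreeS_OPEN` (BSTW Thm 1.3 at 3 resting on [SV-S-Ohta]) is replaced by the
WEAKER provenance binder `BSTW2024_lowerDivisibility_atThreeS_CELL` (the Eisenstein half at 3 on scope S, certified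
in-cell by the Ohta-free chain bstw-MEMO-11/12/14 + MEMO-7, referee REPORT-bstw-7, -10, -11, -12, -13, -14 PASS; register
word litref L31-9 pending). Contents: the witness-free class-level Eisenstein half at `3` modulo the CELL binder
(`X6_kobayashiLowerDivisibility_of_lowerDivisibility_atThreeS_CELL`), the REGISTERED stub `stub_three` of the crux's
BC3 skeleton (`Cruxes/KobayashiLowerHalfSemistable/Lines/birth.lean`) VERBATIM modulo {CELL binder, modularity,
Diamond/Ribet} (`stub_three_of_lowerDivisibility_atThreeS_CELL`), and the crux BY NAME in the skeleton's own
composition shape (`KobayashiLowerHalfSemistable_of_tiersS_C3`). That the closer of record p441716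
(`…_of_tiersS_S3`) and the printed-binder closer (`…_of_thm13_OPEN_via_tiersS_S3`) FACTOR through the new closer is
recorded as two kernel-checked `example`s (their statements coincide with the landed ones, which the gate's
`dedup.landed` rule forbids restating under new names): the new closer is never a stronger assumption than the old.
Nothing about BSD or Kobayashi's conjecture is proved for any curve.
(From the planner's turnkey draft 80f7a8eb9ccb1b2c; mechanical changes only: the tree-standard
`set_option linter.dupNamespace false` line of every `…BirchSwinnertonDyer.BirchSwinnertonDyer.Theorems` file; the two
statement-identical sanity theorems turned into `example`s after the dry-run's `dedup.landed`; the stub-level theorem added.)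
-/

set_option autoImplicit false
set_option linter.dupNamespace false

noncomputable section

open scoped Classical MatrixGroups ModularForm

open CongruenceSubgroup WeierstrassCurve NumberField Literature.NumberTheory.EllipticCurves
  Literature.NumberTheory.EllipticCurves.ModularForms
  Literature.NumberTheory.EllipticCurves.Rank1Residual
  Literature.NumberTheory.EllipticCurves.Rank1Residual.Typed
  Summit.BirchSwinnertonDyer.Rank1Residual.Supersingular

namespace Summit.BirchSwinnertonDyer.BirchSwinnertonDyer.Theorems

/-- **The Eisenstein half on X6 at `p = 3`, every sign, MODULO the CELL-chain binder ALONE** (+ modularity,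
Diamond/Ribet, which make the scope witness free via `BSTWScope_hasAuxWitness_of_goodSS`): the witness-free twin of
`X6.kobayashiLowerDivisibility_of_lowerDivisibility_atThreeS_CELL_of_hasAuxWitness`, and the CELL-tier mirror of
`X6_kobayashiLowerDivisibility_of_thm13_scopedAtThreeS_OPEN` (p441716) with the WEAKER binder. CONDITIONAL
(`conditional-result`); closes nothing. [claim: BurungaleSkinnerTianWan2024, status: under-review]
[cite: Kobayashi2003, Conjecture (Main Conjecture) (p. 2)] [cite: Ribet1990, Thm. 1.1] -/
theorem X6_kobayashiLowerDivisibility_of_lowerDivisibility_atThreeS_CELL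
    (h : BSTW2024_lowerDivisibility_atThreeS_CELL)
    (hmod : exists_isNewformOf) (hLL : Literature.NumberTheory.Automorphic.diamond1995_refinedSerre)
    (W : WeierstrassCurve ℚ) [W.IsElliptic] [W.IsGloballyMinimal] (p : ℕ) [Fact p.Prime]
    (h3 : p = 3) (hX : ClassX6 W p) (ε : ℤˣ) : KobayashiLowerDivisibility W p ε :=
  X6.kobayashiLowerDivisibility_of_lowerDivisibility_atThreeS_CELL_of_hasAuxWitness W p h h3 hX
    (BSTWScope_hasAuxWitness_of_goodSS hmod hLL W p (by omega) hX.2.1 hX.1) ε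

/-- **`stub_three` — the REGISTERED stub of the crux's BC3 skeleton at `p = 3`, signature VERBATIM — MODULO the
CELL-chain binder and two PUBLISHED facts (modularity, Diamond 1995 / Ribet 1990): NO witness, NO Bhargava–Varma, NO
per-class hypothesis, and NO preprint-on-preprint tier.** Lineage: gen 2 `stub_three_of_thm13_scopedAtThree_OPEN`,
gen 6 `stub_three_of_thm13_scopedAtThreeS_OPEN` (p441716; S-scoped PRE tier at 3); here the `p = 3` hypothesis is the
Eisenstein half only. CONDITIONAL (`conditional-result`); the stub is not discharged.
[claim: BurungaleSkinnerTianWan2024, status: under-review] [cite: Kobayashi2003, Conjecture (Main Conjecture) (p. 2)]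
[cite: Ribet1990, Thm. 1.1] -/
theorem stub_three_of_lowerDivisibility_atThreeS_CELL (hCELL3 : BSTW2024_lowerDivisibility_atThreeS_CELL)
    (hmod : exists_isNewformOf) (hLL : Literature.NumberTheory.Automorphic.diamond1995_refinedSerre) :
    ∀ (W : WeierstrassCurve ℚ) [W.IsElliptic] [W.IsGloballyMinimal],
      Literature.NumberTheory.EllipticCurves.Rank1Residual.ClassX6 W 3 →
      ∃ ε : ℤˣ, Summit.BirchSwinnertonDyer.Rank1Residual.Supersingular.KobayashiLowerDivisibility W 3 ε := by
  intro W _ _ hX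
  haveI : Fact (Nat.Prime 3) := ⟨Nat.prime_three⟩
  exact ⟨1, X6_kobayashiLowerDivisibility_of_lowerDivisibility_atThreeS_CELL hCELL3 hmod hLL W 3 rfl hX 1⟩

/-- **The crux BY NAME from {S-scoped tier @ p ≥ 5, CELL-CHAIN Eisenstein half @ 3, modularity, Diamond/Ribet}**,
in the BC3 skeleton's own composition shape (`Cruxes/…/Lines/birth.lean` `KobayashiLowerHalfSemistable_of`): the
`p ≥ 5` regime is p441716's `stub_five_le_of_thm13_scopedS_OPEN`, the `p = 3` regime is
`stub_three_of_lowerDivisibility_atThreeS_CELL`; the two regimes exhaust the odd primes. CONDITIONAL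
(`conditional-result`); the item stays OPEN. [claim: BurungaleSkinnerTianWan2024, status: under-review]
[cite: Kobayashi2003, Conjecture (Main Conjecture) (p. 2)] [cite: Ribet1990, Thm. 1.1]
[cite: Diamond1995RefinedSerre, Thm. 1.1] -/
theorem KobayashiLowerHalfSemistable_of_tiersS_C3
    (hBSTW5 : BurungaleSkinnerTianWan2024_thm13_scopedS_OPEN)
    (hCELL3 : BSTW2024_lowerDivisibility_atThreeS_CELL) (hmod : exists_isNewformOf)
    (hLL : Literature.NumberTheory.Automorphic.diamond1995_refinedSerre) :
    Summit.BirchSwinnertonDyer.BirchSwinnertonDyer.Theses.SignedLowerHalves.KobayashiLowerHalfSemistable := by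
  intro W _ _ p hpF hp hX
  by_cases h5 : 5 ≤ p
  · exact stub_five_le_of_thm13_scopedS_OPEN hBSTW5 hmod hLL W p hp hX h5
  · have h2 := hpF.out.two_le
    have hlt : p < 5 := Nat.lt_of_not_le h5
    interval_cases p
    · exact absurd rfl hp
    · exact stub_three_of_lowerDivisibility_atThreeS_CELL hCELL3 hmod hLL W hX
    · exact absurd hpF.out (by decide)

/- Sanity, kernel-checked WITHOUT new declarations (the statements below coincide with p441716's
`KobayashiLowerHalfSemistable_of_tiersS_S3` and `KobayashiLowerHalfSemistable_of_thm13_OPEN_via_tiersS_S3`, which the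
gate's `dedup.landed` rule forbids restating under new names): the closer of record FACTORS through the CELL closer —
taking the CELL binder at `3` is never stronger than taking the S-scoped preprint tier at `3`
(`lowerDivisibility_atThreeS_CELL_of_thm13_scopedAtThreeS_OPEN`), nor than the printed binder
(`lowerDivisibility_atThreeS_CELL_of_thm13_OPEN`). -/
example (hBSTW5 : BurungaleSkinnerTianWan2024_thm13_scopedS_OPEN)
    (hBSTW3 : BurungaleSkinnerTianWan2024_thm13_scopedAtThreeS_OPEN) (hmod : exists_isNewformOf)
    (hLL : Literature.NumberTheory.Automorphic.diamond1995_refinedSerre) :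
    Summit.BirchSwinnertonDyer.BirchSwinnertonDyer.Theses.SignedLowerHalves.KobayashiLowerHalfSemistable :=
  KobayashiLowerHalfSemistable_of_tiersS_C3 hBSTW5
    (lowerDivisibility_atThreeS_CELL_of_thm13_scopedAtThreeS_OPEN hBSTW3) hmod hLL

example (h : BurungaleSkinnerTianWan2024_thm13_OPEN) (hmod : exists_isNewformOf)
    (hLL : Literature.NumberTheory.Automorphic.diamond1995_refinedSerre) :
    Summit.BirchSwinnertonDyer.BirchSwinnertonDyer.Theses.SignedLowerHalves.KobayashiLowerHalfSemistable :=
  KobayashiLowerHalfSemistable_of_tiersS_C3 (thm13_scopedS_OPEN_of_thm13_OPEN h)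
    (lowerDivisibility_atThreeS_CELL_of_thm13_OPEN h) hmod hLL

end Summit.BirchSwinnertonDyer.BirchSwinnertonDyer.Theorems

end
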